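import Literature.NumberTheory.Transcendental.NesterenkoElimination
import Mathlib.LinearAlgebra.Matrix.Adjugate
import Mathlib.LinearAlgebra.Matrix.MvPolynomial
import Mathlib.RingTheory.Polynomial.UniqueFactorization
import Mathlib.Algebra.MvPolynomial.PDeriv
import Mathlib.Algebra.MvPolynomial.NoZeroDivisors
import Mathlib.Algebra.MvPolynomial.Nilpotent
import HarnessLib

/-!
# The associated (Chow) form of a principal ideal (LNM 1752 Ch. 3 §4, towards Prop. 4.8)

Topic `Literature/NumberTheory/Transcendental`. For the objects of `NesterenkoElimination.lean`
(`K = ℚ`): if `P ∈ ℚ[x₀, …, x_m]` is homogeneous of degree `d ≥ 1` and `U = (u_{ij})`,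
`0 ≤ i < m`, `0 ≤ j ≤ m`, is the generic `m × (m+1)` matrix, let `Δ_j = (−1)^j det U^{(j)}`
(`U^{(j)}` = `U` with column `j` deleted) be its signed maximal minors, so that
`∑_j u_{ij} Δ_j = 0` for every `i` (the `Δ_j` are the coordinates of the point common to the
hyperplanes `L_1 = … = L_m = 0`). Then the ideal `Ī(m)` of Definition 4.3 for `I = (P)` is

  `Ī(m) = (P(Δ_0, …, Δ_m))`,

so that the associated form of `(P)` (Prop. 4.4 / Def. 4.5) is `F = P(Δ_0, …, Δ_m)` up to a
non-zero rational factor (`chowForm_span_singleton`). This is the classical description of the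
Chow form of a hypersurface; it is the algebraic input of [Nes10, Prop. 1.3] = LNM 1752 Ch. 3
Prop. 4.8, whose proof the book does not print. Everything here is PROVED:

* `maxMinor`, `consMatrix`, `det_consMatrix`, `sum_mul_maxMinor` (`U · Δ = 0`),
  `maxMinor_mul_eq` (Cramer: `Δ_k x_j − Δ_j x_k ∈ (L_1, …, L_m)`);
* `isUnit_of_forall_dvd_gMinor`: the maximal minors of a generic matrix have no common
  non-unit divisor (induction on the size via a column expansion and `∂/∂u_{i0}`);
* `dvd_of_forall_dvd_mul_maxMinor_pow`: `F ∣ G Δ_j^M` for all `j` implies `F ∣ G`;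
* `hyperChow P = P(Δ)`, `hyperChow_mem_elimIdeal`, `hyperChow_dvd_of_mem_elimIdeal`,
  `elimIdeal_span_singleton`, `chowForm_span_singleton`.

## References

* [NesterenkoPhilippon2001] Yu. V. Nesterenko, P. Philippon (eds.), *Introduction to Algebraic
  Independence Theory*, LNM 1752, Springer 2001, Ch. 3 §4, Def. 4.3, Prop. 4.4, Prop. 4.8 (p. 40).
* [Nes10] Yu. V. Nesterenko, Proc. Steklov Inst. Math. 218 (1997) 294–331, Prop. 1.3.
-/

noncomputable section

open MvPolynomial Matrix

namespace Literature.NumberTheory.Transcendental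

namespace Nesterenko

/-! ### Signed maximal minors of an `m × (m+1)` matrix and the Cramer identities -/

section Minors

variable {R S : Type*} [CommRing R] [CommRing S] {m : ℕ}

/-- The signed maximal minor `Δ_j(W) = (−1)^j det W^{(j)}`, `W^{(j)}` = `W` with column `j`
deleted. [folklore] -/
def maxMinor (W : Matrix (Fin m) (Fin (m + 1)) R) (j : Fin (m + 1)) : R :=
  (-1) ^ (j : ℕ) * (W.submatrix id j.succAbove).det

/-- The square matrix `[v; W]` obtained by putting the row `v` on top of `W`. [folklore] -/
def consMatrix {α : Type*} (v : Fin (m + 1) → α) (W : Matrix (Fin m) (Fin (m + 1)) α) :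
    Matrix (Fin (m + 1)) (Fin (m + 1)) α :=
  Matrix.of (Fin.cons v W : Fin (m + 1) → Fin (m + 1) → α)

/-- Row `0` of `[v; W]` is `v`. [folklore] -/
@[simp] theorem consMatrix_zero {α : Type*} (v : Fin (m + 1) → α)
    (W : Matrix (Fin m) (Fin (m + 1)) α) : consMatrix v W 0 = v := by
  funext j; simp [consMatrix]

/-- Row `i+1` of `[v; W]` is row `i` of `W`. [folklore] -/
@[simp] theorem consMatrix_succ {α : Type*} (v : Fin (m + 1) → α)
    (W : Matrix (Fin m) (Fin (m + 1)) α) (i : Fin m) : consMatrix v W i.succ = W i := by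
  funext j; simp [consMatrix]

/-- Laplace expansion along the top row: `det [v; W] = ∑_j v_j Δ_j(W)`. [folklore] -/
theorem det_consMatrix (v : Fin (m + 1) → R) (W : Matrix (Fin m) (Fin (m + 1)) R) :
    (consMatrix v W).det = ∑ j, v j * maxMinor W j := by
  rw [Matrix.det_succ_row_zero]
  refine Finset.sum_congr rfl fun j _ => ?_
  rw [maxMinor, consMatrix_zero]
  have : (consMatrix v W).submatrix Fin.succ j.succAbove = W.submatrix id j.succAbove := by
    ext a b
    simp [consMatrix]
  rw [this]
  ring

/-- `U · Δ = 0`: every row of `W` is orthogonal to the vector of signed maximal minors.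
[folklore] -/
theorem sum_mul_maxMinor (W : Matrix (Fin m) (Fin (m + 1)) R) (i : Fin m) :
    ∑ j, W i j * maxMinor W j = 0 := by
  rw [← det_consMatrix]
  exact Matrix.det_zero_of_row_eq (i := 0) (j := i.succ) (Fin.succ_ne_zero i).symm (by simp)

/-- `Δ_k(W) = det [e_k; W]`. [folklore] -/
theorem maxMinor_eq_det (W : Matrix (Fin m) (Fin (m + 1)) R) (k : Fin (m + 1)) :
    maxMinor W k = (consMatrix (Pi.single k 1) W).det := by
  rw [det_consMatrix]
  simp [Pi.single_apply]

/-- Replacing the top row of `[v; W]`. [folklore] -/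
theorem updateRow_consMatrix {α : Type*} (v v' : Fin (m + 1) → α)
    (W : Matrix (Fin m) (Fin (m + 1)) α) :
    (consMatrix v W).updateRow 0 v' = consMatrix v' W := by
  ext r c
  refine Fin.cases ?_ (fun i => ?_) r
  · simp
  · rw [Matrix.updateRow_ne (Fin.succ_ne_zero i), consMatrix_succ, consMatrix_succ]

/-- Signed maximal minors commute with ring homomorphisms. [folklore] -/
theorem map_maxMinor (f : R →+* S) (W : Matrix (Fin m) (Fin (m + 1)) R) (j : Fin (m + 1)) :
    f (maxMinor W j) = maxMinor (W.map f) j := by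
  have : (W.submatrix id j.succAbove).map f = (W.map f).submatrix id j.succAbove := rfl
  simp [maxMinor, RingHom.map_det, this]

/-- **Cramer's identity**: `Δ_k(W) x_j − Δ_j(W) x_k` lies in the ideal generated by the entries
of `W x`. [folklore] -/
theorem maxMinor_mul_eq (W : Matrix (Fin m) (Fin (m + 1)) R) (x : Fin (m + 1) → R)
    (j k : Fin (m + 1)) :
    ∃ c : Fin m → R, maxMinor W k * x j = maxMinor W j * x k + ∑ i, c i * (W *ᵥ x) i := by
  classical
  set A := consMatrix (Pi.single k 1) W with hA
  have h1 : A.adjugate *ᵥ (A *ᵥ x) = maxMinor W k • x := by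
    rw [Matrix.mulVec_mulVec, Matrix.adjugate_mul, Matrix.smul_mulVec, Matrix.one_mulVec,
      maxMinor_eq_det]
  have h2 : ∀ j', A.adjugate j' 0 = maxMinor W j' := by
    intro j'
    rw [Matrix.adjugate_apply, hA, updateRow_consMatrix, ← maxMinor_eq_det]
  have h3 : A *ᵥ x = Fin.cons (x k) (W *ᵥ x) := by
    ext r
    refine Fin.cases ?_ (fun i => ?_) r
    · simp [Matrix.mulVec, hA, dotProduct, Pi.single_apply]
    · simp [Matrix.mulVec, hA, dotProduct]
  rw [h3] at h1
  generalize W *ᵥ x = y at h1 ⊢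
  have h4 := congrFun h1 j
  simp only [Matrix.mulVec, dotProduct, Fin.sum_univ_succ, Fin.cons_zero, Fin.cons_succ,
    Pi.smul_apply, smul_eq_mul, h2] at h4
  exact ⟨fun i => A.adjugate j i.succ, by rw [← h4]⟩

/-- If `W x = 0` then `Δ_k(W) x_j = Δ_j(W) x_k`: the vector `Δ(W)` is proportional to any
vector of the kernel. [folklore] -/
theorem maxMinor_mul_eq_of_mulVec_eq_zero (W : Matrix (Fin m) (Fin (m + 1)) R)
    (x : Fin (m + 1) → R) (hx : W *ᵥ x = 0) (j k : Fin (m + 1)) :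
    maxMinor W k * x j = maxMinor W j * x k := by
  obtain ⟨c, hc⟩ := maxMinor_mul_eq W x j k
  simpa [hx] using hc

/-- `Δ_k(W) x_j − Δ_j(W) x_k ∈ (entries of W x)`. [folklore] -/
theorem maxMinor_mul_sub_mem_span (W : Matrix (Fin m) (Fin (m + 1)) R) (x : Fin (m + 1) → R)
    (j k : Fin (m + 1)) :
    maxMinor W k * x j - maxMinor W j * x k ∈ Ideal.span (Set.range (W *ᵥ x)) := by
  obtain ⟨c, hc⟩ := maxMinor_mul_eq W x j k
  rw [hc, add_sub_cancel_left]
  exact Ideal.sum_mem _ fun i _ => Ideal.mul_mem_left _ _ (Ideal.subset_span ⟨i, rfl⟩)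

end Minors

/-! ### The maximal minors of a generic matrix have no common divisor -/

section Generic

/-- The unsigned maximal minors `det U^{(j)}` of the generic `k × (k+1)` matrix `U = (u_{ij})`
over `ℚ` (entries the variables `(i, j)` of `RU k k = ℚ[u_{ij}]`). [folklore] -/
def gMinor (k : ℕ) (j : Fin (k + 1)) : RU k k :=
  ((mvPolynomialX (Fin k) (Fin (k + 1)) ℚ).submatrix id j.succAbove).det

/-- Signed versus unsigned maximal minors of the generic matrix. [folklore] -/
theorem maxMinor_mvPolynomialX (k : ℕ) (j : Fin (k + 1)) :
    maxMinor (mvPolynomialX (Fin k) (Fin (k + 1)) ℚ) j = (-1) ^ (j : ℕ) * gMinor k j := rfl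

/-- `det U^{(j)}` is the generic `k × k` determinant with its variables renamed. [folklore] -/
theorem gMinor_eq_rename (k : ℕ) (j : Fin (k + 1)) :
    gMinor k j = rename (fun ab : Fin k × Fin k => (ab.1, j.succAbove ab.2))
      (mvPolynomialX (Fin k) (Fin k) ℚ).det := by
  rw [gMinor, AlgHom.map_det]
  congr 1
  ext a b
  simp [mvPolynomialX]

/-- The maximal minors of the generic matrix are non-zero. [folklore] -/
theorem gMinor_ne_zero (k : ℕ) (j : Fin (k + 1)) : gMinor k j ≠ 0 := by
  rw [gMinor_eq_rename]
  refine (map_ne_zero_iff _ (rename_injective _ ?_)).mpr (det_mvPolynomialX_ne_zero _ _)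
  intro a b h
  simp only [Prod.mk.injEq] at h
  exact Prod.ext h.1 (Fin.succAbove_right_injective h.2)

/-- A variable outside the range of a renaming does not occur in the renamed polynomial.
[folklore] -/
theorem degreeOf_rename_of_not_mem_range {σ τ R : Type*} [CommSemiring R] (f : σ → τ)
    (p : MvPolynomial σ R) {v : τ} (hv : v ∉ Set.range f) : degreeOf v (rename f p) = 0 := by
  classical
  by_contra h
  have h1 := mem_vars_iff_degreeOf_ne_zero.mpr h
  obtain ⟨a, -, rfl⟩ := Finset.mem_image.mp (vars_rename f p h1)
  exact hv ⟨a, rfl⟩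

/-- A variable outside the range of a renaming is not a variable of the renamed polynomial.
[folklore] -/
theorem not_mem_vars_rename_of_not_mem_range {σ τ R : Type*} [CommSemiring R] (f : σ → τ)
    (p : MvPolynomial σ R) {v : τ} (hv : v ∉ Set.range f) : v ∉ (rename f p).vars := by
  classical
  intro h1
  obtain ⟨a, -, rfl⟩ := Finset.mem_image.mp (vars_rename f p h1)
  exact hv ⟨a, rfl⟩

/-- In `ℚ[U]` a divisor of a non-zero polynomial not involving a variable does not involve it
either. [folklore] -/
theorem degreeOf_eq_zero_of_dvd {σ : Type*} {p q : MvPolynomial σ ℚ} (v : σ) (h : p ∣ q)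
    (hq : q ≠ 0) (hv : degreeOf v q = 0) : degreeOf v p = 0 := by
  obtain ⟨r, rfl⟩ := h
  rw [degreeOf_mul_eq (left_ne_zero_of_mul hq) (right_ne_zero_of_mul hq)] at hv
  omega

/-- The cofactors `C_i = det` of `U` with row `i` and columns `0, 1` deleted (for the generic
`(k+1) × (k+2)` matrix). [folklore] -/
def gCof (k : ℕ) (i : Fin (k + 1)) : RU (k + 1) (k + 1) :=
  ((mvPolynomialX (Fin (k + 1)) (Fin (k + 2)) ℚ).submatrix i.succAbove
    (Fin.succ ∘ Fin.succ)).det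

/-- The renaming `ℚ[u_{cr} : c < k, r ≤ k] → ℚ[u_{ij} : i ≤ k, j ≤ k+1]`, `u_{cr} ↦ u_{r, c+2}`
(transpose and shift two columns). [folklore] -/
def shiftVar (k : ℕ) (cr : Fin k × Fin (k + 1)) : Fin (k + 1) × Fin (k + 2) :=
  (cr.2, cr.1.succ.succ)

/-- `shiftVar` is injective. [folklore] -/
theorem shiftVar_injective (k : ℕ) : Function.Injective (shiftVar k) := by
  rintro ⟨c, r⟩ ⟨c', r'⟩ h
  simp only [shiftVar, Prod.mk.injEq, Fin.succ_inj] at h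
  exact Prod.ext h.2 h.1

/-- The cofactors `C_i` are the maximal minors of the generic `k × (k+1)` matrix, transposed and
with shifted variables. [folklore] -/
theorem gCof_eq_rename (k : ℕ) (i : Fin (k + 1)) :
    gCof k i = rename (shiftVar k) (gMinor k i) := by
  rw [gMinor, AlgHom.map_det, gCof, ← Matrix.det_transpose]
  congr 1
  ext a b
  simp [mvPolynomialX, shiftVar]

/-- Column expansion `det U^{(0)} = ∑_i (−1)^i u_{i1} C_i`. [folklore] -/
theorem gMinor_succ_zero (k : ℕ) :
    gMinor (k + 1) 0 = ∑ i : Fin (k + 1), (-1) ^ (i : ℕ) * X (i, 1) * gCof k i := by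
  rw [gMinor, Matrix.det_succ_column_zero]
  refine Finset.sum_congr rfl fun i _ => ?_
  have h1 : ((mvPolynomialX (Fin (k + 1)) (Fin (k + 2)) ℚ).submatrix id
      (0 : Fin (k + 2)).succAbove) i 0 = X (i, 1) := by
    simp [mvPolynomialX]
  have h2 : (((mvPolynomialX (Fin (k + 1)) (Fin (k + 2)) ℚ).submatrix id
      (0 : Fin (k + 2)).succAbove)).submatrix i.succAbove Fin.succ =
      (mvPolynomialX (Fin (k + 1)) (Fin (k + 2)) ℚ).submatrix i.succAbove
        (Fin.succ ∘ Fin.succ) := by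
    ext a b
    simp [mvPolynomialX]
  rw [h1, h2, gCof]

/-- `Fin` bookkeeping: skipping `1` sends `b+1` to `b+2`. [folklore] -/
theorem one_succAbove_succ (k : ℕ) (b : Fin (k + 1)) :
    (1 : Fin (k + 3)).succAbove b.succ = b.succ.succ := by
  have : (1 : Fin (k + 3)) = (0 : Fin (k + 2)).succ := rfl
  rw [this, Fin.succ_succAbove_succ, Fin.succAbove_zero]

/-- Column expansion `det U^{(1)} = ∑_i (−1)^i u_{i0} C_i` (same cofactors). [folklore] -/
theorem gMinor_succ_one (k : ℕ) :
    gMinor (k + 1) 1 = ∑ i : Fin (k + 1), (-1) ^ (i : ℕ) * X (i, 0) * gCof k i := by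
  rw [gMinor, Matrix.det_succ_column_zero]
  refine Finset.sum_congr rfl fun i _ => ?_
  have h1 : ((mvPolynomialX (Fin (k + 1)) (Fin (k + 2)) ℚ).submatrix id
      (1 : Fin (k + 2)).succAbove) i 0 = X (i, 0) := by
    simp [mvPolynomialX, Fin.succAbove_ne_zero_zero (a := (1 : Fin (k + 2))) one_ne_zero]
  have h2 : (((mvPolynomialX (Fin (k + 1)) (Fin (k + 2)) ℚ).submatrix id
      (1 : Fin (k + 2)).succAbove)).submatrix i.succAbove Fin.succ =
      (mvPolynomialX (Fin (k + 1)) (Fin (k + 2)) ℚ).submatrix i.succAbove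
        (Fin.succ ∘ Fin.succ) := by
    ext a b
    simp only [submatrix_apply, id_eq, mvPolynomialX_apply, Function.comp_apply]
    congr 2
  rw [h1, h2, gCof]

/-- `det U^{(0)}` does not involve the variables `u_{i0}`. [folklore] -/
theorem degreeOf_gMinor_succ_zero (k : ℕ) (i : Fin (k + 1)) :
    degreeOf (i, (0 : Fin (k + 2))) (gMinor (k + 1) 0) = 0 := by
  rw [gMinor_eq_rename]
  refine degreeOf_rename_of_not_mem_range _ _ ?_
  rintro ⟨⟨a, b⟩, h⟩
  simp only [Prod.mk.injEq, Fin.succAbove_zero] at h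
  exact Fin.succ_ne_zero _ h.2

/-- `det U^{(1)}` does not involve the variables `u_{i1}`. [folklore] -/
theorem degreeOf_gMinor_succ_one (k : ℕ) (i : Fin (k + 1)) :
    degreeOf (i, (1 : Fin (k + 2))) (gMinor (k + 1) 1) = 0 := by
  rw [gMinor_eq_rename]
  refine degreeOf_rename_of_not_mem_range _ _ ?_
  rintro ⟨⟨a, b⟩, h⟩
  simp only [Prod.mk.injEq] at h
  exact Fin.succAbove_ne _ _ h.2

/-- The cofactors `C_i` do not involve the variables `u_{i'0}`. [folklore] -/
theorem not_mem_vars_gCof (k : ℕ) (i i' : Fin (k + 1)) :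
    (i', (0 : Fin (k + 2))) ∉ (gCof k i).vars := by
  rw [gCof_eq_rename]
  refine not_mem_vars_rename_of_not_mem_range _ _ ?_
  rintro ⟨⟨c, r⟩, h⟩
  simp only [shiftVar, Prod.mk.injEq] at h
  exact Fin.succ_ne_zero _ h.2

/-- `∂/∂u_{i0} det U^{(1)} = (−1)^i C_i`. [folklore] -/
theorem pderiv_gMinor_succ_one (k : ℕ) (i : Fin (k + 1)) :
    pderiv (i, (0 : Fin (k + 2))) (gMinor (k + 1) 1) = (-1) ^ (i : ℕ) * gCof k i := by
  rw [gMinor_succ_one, map_sum]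
  rw [Finset.sum_eq_single i]
  · rw [Derivation.leibniz, pderiv_eq_zero_of_notMem_vars (not_mem_vars_gCof k i i), smul_zero,
      zero_add, Derivation.leibniz, pderiv_X]
    simp [mul_comm]
  · intro i' _ hi'
    rw [Derivation.leibniz, pderiv_eq_zero_of_notMem_vars (not_mem_vars_gCof k i' i), smul_zero,
      zero_add, Derivation.leibniz, pderiv_X]
    have : (i', (0 : Fin (k + 2))) ≠ (i, 0) := by simpa using hi'
    simp [this]
  · intro h; exact absurd (Finset.mem_univ i) h

/-- **No common divisor.** Every common divisor of the maximal minors `det U^{(0)}, …,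
det U^{(k)}` of the generic `k × (k+1)` matrix is a unit of `ℚ[U]`. (Induction on `k`:
expanding `det U^{(0)}` and `det U^{(1)}` along the columns `u_{•1}`, `u_{•0}` exhibits the
same cofactors, the maximal minors of a generic `(k−1) × k` matrix in the remaining variables;
a common divisor involves neither `u_{•0}` nor `u_{•1}`, so `∂/∂u_{i0}` shows that it divides
every cofactor.) [folklore] -/
theorem isUnit_of_forall_dvd_gMinor :
    ∀ (k : ℕ) (q : RU k k), (∀ j, q ∣ gMinor k j) → IsUnit q := by
  intro k
  induction k with
  | zero =>
    intro q h
    have h0 := h 0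
    rw [gMinor, Matrix.det_fin_zero] at h0
    exact isUnit_of_dvd_one h0
  | succ k ih =>
    intro q h
    have hq0 : q ≠ 0 := by
      rintro rfl
      exact gMinor_ne_zero _ _ (zero_dvd_iff.mp (h 0))
    -- the variables of `q` avoid the columns `0` and `1`
    have h0 : ∀ i, degreeOf (i, (0 : Fin (k + 2))) q = 0 := fun i =>
      degreeOf_eq_zero_of_dvd _ (h 0) (gMinor_ne_zero _ _) (degreeOf_gMinor_succ_zero k i)
    have h1 : ∀ i, degreeOf (i, (1 : Fin (k + 2))) q = 0 := fun i =>
      degreeOf_eq_zero_of_dvd _ (h 1) (gMinor_ne_zero _ _) (degreeOf_gMinor_succ_one k i)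
    -- `q` divides every cofactor
    have h2 : ∀ i, q ∣ gCof k i := by
      intro i
      obtain ⟨r, hr⟩ := h 1
      have hd := congrArg (pderiv (i, (0 : Fin (k + 2)))) hr
      rw [pderiv_gMinor_succ_one, Derivation.leibniz,
        pderiv_eq_zero_of_notMem_vars
          (fun hm => (mem_vars_iff_degreeOf_ne_zero.mp hm) (h0 i)), smul_zero, add_zero,
        smul_eq_mul] at hd
      have : q ∣ (-1) ^ (i : ℕ) * gCof k i := ⟨_, hd⟩
      exact ((IsUnit.neg isUnit_one).pow _).dvd_mul_left.mp this
    -- `q` comes from the smaller ring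
    obtain ⟨q₀, rfl⟩ : ∃ q₀, rename (shiftVar k) q₀ = q := by
      refine exists_rename_eq_of_vars_subset_range q _ (shiftVar_injective k) ?_
      rintro ⟨a, b⟩ hab
      have hb0 : b ≠ 0 := by
        rintro rfl
        exact (mem_vars_iff_degreeOf_ne_zero.mp (Finset.mem_coe.mp hab)) (h0 a)
      have hb1 : b ≠ 1 := by
        rintro rfl
        exact (mem_vars_iff_degreeOf_ne_zero.mp (Finset.mem_coe.mp hab)) (h1 a)
      obtain ⟨b', rfl⟩ := Fin.exists_succ_eq.mpr hb0
      have hb' : b' ≠ 0 := by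
        rintro rfl
        exact hb1 rfl
      obtain ⟨c, rfl⟩ := Fin.exists_succ_eq.mpr hb'
      exact ⟨(c, a), rfl⟩
    have h4 : ∀ i, q₀ ∣ gMinor k i := by
      intro i
      have := map_dvd (killCompl (shiftVar_injective k)) ((h2 i).trans (gCof_eq_rename k i).dvd)
      rwa [killCompl_rename_app, killCompl_rename_app] at this
    exact (ih q₀ h4).map _

/-- No prime of `ℚ[U]` divides all the signed maximal minors of the generic `m × (m+1)`
matrix. [folklore] -/
theorem exists_not_dvd_maxMinor (m : ℕ) {p : RU m m} (hp : Prime p) :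
    ∃ j, ¬ p ∣ maxMinor (mvPolynomialX (Fin m) (Fin (m + 1)) ℚ) j := by
  by_contra h
  push Not at h
  refine hp.not_unit (isUnit_of_forall_dvd_gMinor m p fun j => ?_)
  have := h j
  rw [maxMinor_mvPolynomialX] at this
  exact ((IsUnit.neg isUnit_one).pow _).dvd_mul_left.mp this

/-- The signed maximal minors of the generic matrix are non-zero. [folklore] -/
theorem maxMinor_mvPolynomialX_ne_zero (m : ℕ) (j : Fin (m + 1)) :
    maxMinor (mvPolynomialX (Fin m) (Fin (m + 1)) ℚ) j ≠ 0 := by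
  rw [maxMinor_mvPolynomialX]
  exact mul_ne_zero (pow_ne_zero _ (neg_ne_zero.mpr one_ne_zero)) (gMinor_ne_zero m j)

/-- If `F ∣ G Δ_j^M` for every `j`, then `F ∣ G`. [folklore] -/
theorem dvd_of_forall_dvd_mul_maxMinor_pow (m M : ℕ) (F : RU m m) :
    ∀ G : RU m m, (∀ j, F ∣ G * maxMinor (mvPolynomialX (Fin m) (Fin (m + 1)) ℚ) j ^ M) →
      F ∣ G := by
  induction F using UniqueFactorizationMonoid.induction_on_prime with
  | h₁ =>
    intro G hG
    have h0 := hG 0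
    rw [zero_dvd_iff, mul_eq_zero] at h0
    rcases h0 with h0 | h0
    · rw [h0]
    · exact absurd (pow_eq_zero_iff'.mp h0).1 (maxMinor_mvPolynomialX_ne_zero m 0)
  | h₂ F hF => exact fun G _ => hF.dvd
  | h₃ a p ha hp ih =>
    intro G hG
    obtain ⟨j₀, hj₀⟩ := exists_not_dvd_maxMinor m hp
    have hpG : p ∣ G := by
      rcases hp.dvd_or_dvd ((dvd_mul_right p a).trans (hG j₀)) with h | h
      · exact h
      · exact absurd (hp.dvd_of_dvd_pow h) hj₀
    obtain ⟨G', rfl⟩ := hpG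
    refine mul_dvd_mul_left p (ih G' fun j => ?_)
    have := hG j
    rw [mul_assoc] at this
    exact (mul_dvd_mul_iff_left hp.ne_zero).mp this

end Generic

/-! ### The associated form of `(P)` -/

section Hypersurface

variable {m : ℕ}

/-- The vector `Δ = (Δ_0, …, Δ_m)` of signed maximal minors of the generic `m × (m+1)` matrix
`U`, `Δ_j ∈ ℚ[U] = RU m m`. [folklore] -/
def genDelta (m : ℕ) (j : Fin (m + 1)) : RU m m :=
  maxMinor (mvPolynomialX (Fin m) (Fin (m + 1)) ℚ) j

/-- `F = P(Δ_0, …, Δ_m) ∈ ℚ[U]`: the associated form of the hypersurface `P = 0`.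
[cite: NesterenkoPhilippon2001, Ch. 3 Prop. 4.8 (p. 40)] -/
def hyperChow (P : Rx m) : RU m m :=
  aeval (genDelta m) P

/-- Homogeneous polynomials rescale: `P(c v) = c^d P(v)`. [folklore] -/
theorem aeval_mul_of_isHomogeneous {σ A : Type*} [CommRing A] [Algebra ℚ A]
    {P : MvPolynomial σ ℚ} {d : ℕ} (hP : P.IsHomogeneous d) (c : A) (v : σ → A) :
    aeval (fun i => c * v i) P = c ^ d * aeval v P := by
  classical
  conv_lhs => rw [P.as_sum]
  conv_rhs => rw [P.as_sum]
  rw [map_sum, map_sum, Finset.mul_sum]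
  refine Finset.sum_congr rfl fun e he => ?_
  have hdeg : ∑ i ∈ e.support, e i = d := by
    have := hP (mem_support_iff.mp he)
    simpa [Finsupp.weight_apply, Finsupp.sum] using this
  rw [aeval_monomial, aeval_monomial]
  simp only [Finsupp.prod, mul_pow, Finset.prod_mul_distrib, Finset.prod_pow_eq_pow_sum, hdeg]
  ring

/-- `ℚ`-algebra maps commute with `aeval`. [folklore] -/
theorem map_aeval_eq {σ A B : Type*} [CommRing A] [CommRing B] [Algebra ℚ A] [Algebra ℚ B]
    (φ : A →ₐ[ℚ] B) (v : σ → A) (P : MvPolynomial σ ℚ) :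
    φ (aeval v P) = aeval (fun i => φ (v i)) P := by
  rw [← AlgHom.comp_apply, comp_aeval]

/-- The generic matrix `U` with its entries viewed in `ℚ[U, x̲]`. [folklore] -/
def genMatUX (m : ℕ) : Matrix (Fin m) (Fin (m + 1)) (RUX m m) :=
  (mvPolynomialX (Fin m) (Fin (m + 1)) ℚ).map (rename Sum.inl)

/-- The vector `x̲ = (x_0, …, x_m)` of `ℚ[U, x̲]`. [folklore] -/
def xVec (m : ℕ) : Fin (m + 1) → RUX m m := fun j => X (Sum.inr j)

/-- `(U x̲)_i = L_i`, the generic linear forms of Definition 4.3.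
[cite: NesterenkoPhilippon2001, Ch. 3 §4 (p. 38)] -/
theorem genMatUX_mulVec_xVec (m : ℕ) (i : Fin m) :
    (genMatUX m *ᵥ xVec m) i = linForm m m i := by
  simp [genMatUX, xVec, linForm, Matrix.mulVec, dotProduct, mvPolynomialX]

/-- `Δ_k` viewed in `ℚ[U, x̲]` is the signed maximal minor of `U` viewed there. [folklore] -/
theorem rename_inl_genDelta (k : Fin (m + 1)) :
    rename Sum.inl (genDelta m k) = maxMinor (genMatUX m) k :=
  map_maxMinor (rename Sum.inl : RU m m →ₐ[ℚ] RUX m m).toRingHom _ k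

/-- Renaming variables is evaluation at variables. [folklore] -/
theorem rename_eq_aeval_X {σ τ : Type*} (f : σ → τ) (p : MvPolynomial σ ℚ) :
    rename f p = aeval (fun i => X (f i)) p := by
  rw [← aeval_X_left_apply (rename f p), aeval_rename]
  rfl

/-- **`F ∈ Ī(m)`**: for `P` homogeneous of degree `d ≥ 1`, `x_j^d · P(Δ) ∈ (P, L_1, …, L_m)`
for every `j`. [cite: NesterenkoPhilippon2001, Ch. 3 Def. 4.3, Prop. 4.8] -/
theorem hyperChow_mem_elimIdeal {P : Rx m} {d : ℕ} (hP : P.IsHomogeneous d) (hd : 0 < d) :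
    hyperChow P ∈ elimIdeal (Ideal.span {P}) m := by
  classical
  refine ⟨d, hd, fun j => ?_⟩
  have hL : ∀ i, (genMatUX m *ᵥ xVec m) i ∈ extIdeal (Ideal.span {P}) m := fun i =>
    Ideal.mem_sup_right (Ideal.subset_span ⟨i, (genMatUX_mulVec_xVec m i).symm⟩)
  -- Cramer in the quotient
  have hq : ∀ k, Ideal.Quotient.mk (extIdeal (Ideal.span {P}) m)
      (xVec m j * maxMinor (genMatUX m) k) =
      Ideal.Quotient.mk (extIdeal (Ideal.span {P}) m) (maxMinor (genMatUX m) j * xVec m k) := by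
    intro k
    rw [Ideal.Quotient.eq, mul_comm (xVec m j)]
    have hsub : Ideal.span (Set.range (genMatUX m *ᵥ xVec m)) ≤ extIdeal (Ideal.span {P}) m := by
      rw [Ideal.span_le]
      rintro _ ⟨i, rfl⟩
      exact hL i
    exact hsub (maxMinor_mul_sub_mem_span (genMatUX m) (xVec m) j k)
  have hF : rename Sum.inl (hyperChow P) = aeval (maxMinor (genMatUX m)) P := by
    rw [hyperChow, map_aeval_eq]
    simp_rw [rename_inl_genDelta]
  have hPx : aeval (xVec m) P = rename Sum.inr P := (rename_eq_aeval_X _ P).symm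
  have hmem : rename Sum.inr P ∈ extIdeal (Ideal.span {P}) m :=
    Ideal.mem_sup_left (Ideal.mem_map_of_mem _ (Ideal.mem_span_singleton_self P))
  -- `x_j^d F ≡ Δ_j^d P(x) (mod J)`
  have key : Ideal.Quotient.mk (extIdeal (Ideal.span {P}) m)
      (xVec m j ^ d * aeval (maxMinor (genMatUX m)) P) =
      Ideal.Quotient.mk (extIdeal (Ideal.span {P}) m)
      (maxMinor (genMatUX m) j ^ d * aeval (xVec m) P) := by
    rw [← aeval_mul_of_isHomogeneous hP, ← aeval_mul_of_isHomogeneous hP,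
      ← Ideal.Quotient.mkₐ_eq_mk ℚ, map_aeval_eq, map_aeval_eq]
    congr 2
    funext k
    exact hq k
  rw [Ideal.Quotient.eq] at key
  have h2 : maxMinor (genMatUX m) j ^ d * aeval (xVec m) P ∈ extIdeal (Ideal.span {P}) m := by
    rw [hPx]
    exact Ideal.mul_mem_left _ _ hmem
  have h3 := (extIdeal (Ideal.span {P}) m).add_mem key h2
  rw [sub_add_cancel, ← hF, mul_comm] at h3
  exact h3

/-- **`Ī(m) ⊆ (F)`**: specialising `x ↦ Δ` kills `L_1, …, L_m` and sends `P` to `F`, so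
`G ∈ Ī(m)` gives `F ∣ G Δ_j^M` for all `j`, whence `F ∣ G`.
[cite: NesterenkoPhilippon2001, Ch. 3 Def. 4.3, Prop. 4.8] -/
theorem hyperChow_dvd_of_mem_elimIdeal {P : Rx m} {G : RU m m}
    (hG : G ∈ elimIdeal (Ideal.span {P}) m) : hyperChow P ∣ G := by
  classical
  obtain ⟨M, -, hM⟩ := hG
  set φ : RUX m m →ₐ[ℚ] RU m m := aeval (Sum.elim X (genDelta m)) with hφ
  have hφG : φ (rename Sum.inl G) = G := by
    rw [hφ, aeval_rename]
    exact aeval_X_left_apply G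
  have hφJ : extIdeal (Ideal.span {P}) m ≤ Ideal.comap φ (Ideal.span {hyperChow P}) := by
    refine sup_le ?_ ?_
    · rw [Ideal.map_le_iff_le_comap, Ideal.span_singleton_le_iff_mem, Ideal.mem_comap,
        Ideal.mem_comap]
      have : φ (rename Sum.inr P) = hyperChow P := by
        rw [hφ, aeval_rename]; rfl
      rw [this]
      exact Ideal.mem_span_singleton_self _
    · rw [Ideal.span_le]
      rintro _ ⟨i, rfl⟩
      rw [SetLike.mem_coe, Ideal.mem_comap]
      have : φ (linForm m m i) = 0 := by
        simp only [linForm, map_sum, map_mul, hφ, aeval_X, Sum.elim_inl, Sum.elim_inr]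
        exact sum_mul_maxMinor (mvPolynomialX (Fin m) (Fin (m + 1)) ℚ) i
      rw [this]
      exact Ideal.zero_mem _
  refine dvd_of_forall_dvd_mul_maxMinor_pow m M (hyperChow P) G fun j => ?_
  have := hφJ (hM j)
  rw [Ideal.mem_comap, map_mul, map_pow, hφG, Ideal.mem_span_singleton] at this
  simpa [hφ, genDelta] using this

/-- **The ideal `Ī(m)` of a principal ideal**: for `P` homogeneous of degree `d ≥ 1`,
`Ī(m) = (P(Δ_0, …, Δ_m))` for `I = (P)`. [cite: NesterenkoPhilippon2001, Ch. 3 Prop. 4.4,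
Prop. 4.8 (p. 40)] -/
theorem elimIdeal_span_singleton {P : Rx m} {d : ℕ} (hP : P.IsHomogeneous d) (hd : 0 < d) :
    elimIdeal (Ideal.span {P}) m = Ideal.span {hyperChow P} := by
  refine le_antisymm (fun G hG => Ideal.mem_span_singleton.mpr
    (hyperChow_dvd_of_mem_elimIdeal hG)) ?_
  rw [Ideal.span_singleton_le_iff_mem]
  exact hyperChow_mem_elimIdeal hP hd

/-- **The associated form of `(P)`** is `c · P(Δ_0, …, Δ_m)` for a non-zero rational `c`.
[cite: NesterenkoPhilippon2001, Ch. 3 Prop. 4.4, Def. 4.5, Prop. 4.8 (p. 40)] -/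
theorem chowForm_span_singleton {P : Rx m} {d : ℕ} (hP : P.IsHomogeneous d) (hd : 0 < d) :
    ∃ c : ℚ, c ≠ 0 ∧ chowForm (Ideal.span {P}) m = C c * hyperChow P := by
  have hprinc : (elimIdeal (Ideal.span {P}) m).IsPrincipal := by
    rw [elimIdeal_span_singleton hP hd]
    exact ⟨⟨hyperChow P, (Ideal.submodule_span_eq).symm⟩⟩
  have h := span_chowForm (Ideal.span {P}) m hprinc
  rw [elimIdeal_span_singleton hP hd, Ideal.span_singleton_eq_span_singleton] at h
  obtain ⟨u, hu⟩ := h.symm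
  obtain ⟨r, hr, hru⟩ := (isUnit_iff_eq_C_of_isReduced (P := (u : RU m m))).mp u.isUnit
  refine ⟨r, hr.ne_zero, ?_⟩
  rw [← hu, hru, mul_comm]

end Hypersurface

end Nesterenko

end Literature.NumberTheory.Transcendental

end
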